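import Summits.HodgeConjecture.HodgeConjecture.Theses.NodalThetaWeil
import Literature.AlgebraicGeometry.HodgeTheory.NodalDivisor
import Literature.AlgebraicGeometry.HodgeTheory.WeilClassesHodgeType
import Literature.AlgebraicGeometry.HodgeTheory.WeilClassesRationalPlane
import Literature.AlgebraicGeometry.HodgeTheory.WeilClassesSixfoldsProofs
import Literature.AlgebraicGeometry.HodgeTheory.SupportedHodgeClassesAlgebraic
import Literature.AlgebraicGeometry.HodgeTheory.ComplexOrientationFamily
import Literature.AlgebraicGeometry.Motives.CartierDivisorOfIdealSheaf
import Literature.AlgebraicGeometry.Motives.MumfordTateInvariantsSubHodge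
import Literature.AlgebraicTopology.SingularHomology.GysinMapSupportProofs
import HarnessLib

/-!
# Crux `NodeDualClassesAlgebraic` (stmt-HodgeConjecture-7745) — the NODAL BOUNDARY line:
# K-RIGIDITY OF ALGEBRAICITY ON THE WEIL PLANE, and the crux from ONE explicit cycle at the nodes

Route `HodgeConjecture/NodalThetaWeil`. Second prover lane (width lever): the explicit construction at the
nodal boundary, with NO transport and NO monodromy. Companion (and `N³`-mirror) of the sibling crux's file
`NodalThetaWeilNodalThetaSupportWeilPlaneConiveauRigidity.lean` (crux `NodalThetaSupport`, stmt-7744: ONE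
Weil-visible class SUPPORTED on a nodal theta member puts the Weil plane in `N¹H⁶`). Here: ONE Weil-visible
ALGEBRAIC class — the class of a threefold through the nodes of a nodal member of `|kΘ|`, i.e. a node-dual
class of the resolved divisor REALISED by an explicit cycle (Thomas 2005 §3 eq. (d) = Schoen 1985 Lemma 1.1:
the new `(2,2)`-classes of the resolution `D̃⁵` of a nodal `D ∈ |kΘ|` are the node-dual lattice
`⟨Aᵢ − Bᵢ⟩^*`; the route: "expected to be carried by threefolds `V ⊂ D` through the nodes with `T_pV`
maximal isotropic for the Hessian quadric") — puts the whole Weil plane in `N³H⁶ = algebraicClasses A.X 3`,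
hence `WeilSixfolds` and the crux `NodeDualClassesAlgebraic` for that sixfold.

WEIL-VISIBILITY is Thomas's period-free certificate ("`π_W` is a polynomial in the `K`-action", route
header): for some test isogeny `ψ = x·𝟙 + y·φ` and some polynomial `p`, `t := p(ψ^*) s` is a NON-ZERO class
of the Weil plane `W = E₊ ⊔ E₋ = weilClassesOf A φ 3 d`. The same display predicate `IsWeilVisible` and the
same `IsNodalThetaMember` as in the 7744 file, so that the two cruxes of the route consume ONE language.

## What is proved (no `sorry`, no new definition, no named fact; every input is a theorem of the tree)

§1 **K-rigidity of algebraicity** (`weilClassesOf_le_algebraicClasses_of_weilVisible`, any `n ≥ 1`): on a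
complex abelian `2n`-fold `(A, φ ≫ φ = -d·𝟙)`, `d ≥ 1`, if an ALGEBRAIC class `s ∈ Nⁿ H²ⁿ(A(ℂ); ℂ)` is
Weil-visible then `W ≤ Nⁿ H²ⁿ`. Proof: `Nⁿ H²ⁿ` is stable under every `(x·𝟙 + y·φ)^*` (isogenies act by
algebraic correspondences, `map_nsmul_id_add_nsmul_mem_algebraicClasses`), hence under `p(ψ^*)`
(`HodgeStructure.aeval_apply_mem_of_forall_mem`); so `t` is a non-zero algebraic class of `W`, and ONE such
class makes `W` algebraic (`weilClassesOf_le_algebraicClasses_of_exists_ne_zero`: both Weil components of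
`t` are algebraic, one spans its line — `dim E± = 1` from `H•(A(ℂ)) = ⋀• H¹`, `b₁ = 4n`, the tree's
`hasExteriorCohomologyH1_complexPoints` / `finrank_complexBetti_one` — and its complex conjugate spans the
other).

§2 **The explicit cycles, in Gysin form** (the tree's `map_complexGysin_algebraicClasses_le`, Fulton App. B):
the class `h_*b ∈ H⁶(A(ℂ); ℂ)` of a smooth projective THREEFOLD `h : V ⟶ A` (`b ∈ H⁰(V(ℂ); ℂ) = N⁰H⁰`) is
algebraic (`complexGysin_threefold_mem_algebraicClasses`), and so is the Gysin image `g_*b` of a REALISED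
node-dual class `b ∈ N²H⁴(Y(ℂ); ℂ)` of a smooth projective fivefold `g : Y ⟶ A` — the resolved nodal divisor
(`complexGysin_fivefold_mem_algebraicClasses`: the birth skeleton's STUB 2 `stub_liftedTwoTwoClassesAlgebraic`
holds for the realised classes; its open content is `b ∈ N²H⁴(Y)` for a RATIONAL `(2,2)`-class `b`).

§3 **The crux and the target BY NAME from the nodal-boundary carrier statement**
(`weilSixfolds_of_nodalThetaIsotropicThreefold`, `nodeDualClassesAlgebraic_of_nodalThetaIsotropicThreefold`):
IF every BALANCED Weil sixfold (`dim (V₊ ∩ H^{1,0}) = 3`; otherwise its rational `(3,3)` Weil classes are `0`,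
Deligne–Milne 4.4) carries an ample `Θ`, `k ≥ 2`, a nodal member `ι : D ↪ A` of `|kΘ|`, and a smooth
projective threefold `h : V ⟶ D` THROUGH A NODE whose class `(h ≫ ι)_* b` is Weil-visible, THEN
`WeilSixfolds` (stmt-2524) and `NodeDualClassesAlgebraic` (stmt-7745). HONEST NOTE on what the proof
consumes: only "an algebraic Weil-visible class" (§4's minimal form); `Θ`, `k`, nodality and "through a
node" LOCATE the construction (the route's engine: Thomas's Thm. 1, nodal members of `|kΘ|`, `k ≥ 2`) and are
not used by the glue — exactly as `Θ.IsAmple ∧ 2 ≤ k` are carried unused by the 7744 composition. At `n = 3`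
the isotropic-tangent-space clause is automatic: a general high multiple of `Θ` through a threefold
`V ⊂ A⁶` is nodal with its nodes on `V` and `T_pV` a maximal isotropic subspace of the tangent quadric
(`2·dim V = dim A`; Kleiman–Altman Bertini), so the nodal clause costs nothing GIVEN the cycle — the
content of the residual is the cycle and its certificate.

§4 **The minimal form is an honest equivalence split**
(`weilSixfolds_pointwise_iff_exists_weilVisible_algebraic`): on a balanced Weil sixfold, (every rational
`(3,3)` Weil class is algebraic) `↔` (some algebraic class of `H⁶` is Weil-visible) — `→`: a non-zero
RATIONAL class of the Weil plane (`exists_isRationalClass_ne_zero_mem_weilClassesOf`) is of type `(3,3)`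
(`isOfHodgeType_of_mem_weilClassesOf`), algebraic by hypothesis, and visible with `ψ = 𝟙`, `p = X`.
So the residual of §3 is the Hodge conjecture for the Weil plane of that sixfold IN CERTIFICATE FORM — not
weaker, not stronger (modulo the free nodal clause) — and differs from the birth line's STUB 2 (which asks
`g_*b ∈ N³` for EVERY fivefold `g : Y ⟶ A` and EVERY rational `(2,2)`-class `b`, HC(2,2)-strength) by
asking for ONE cycle with a non-vanishing certificate.

HONEST STATUS. Nothing here is a case of the Hodge conjecture; the crux stays open; the file turns the
crux, for each sixfold, into "exhibit one threefold at the nodes whose class passes the `K`-certificate".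
References: [Thomas2005Nodes] Thm. 1, §3 Lemmas 3–4 and eq. (d), §4; [Schoen1985] Lemma 1.1;
[vanGeemen1994HodgeAV] 4.9–4.11, Lemma 5.2, proof of Thm. 6.12; [Deligne1982HodgeCycles] Prop. 4.4;
[Markman2025SecantWeil] proof of Thm. 1.5.1 (`η(K)` acts by algebraic correspondences);
[FultonYoungTableaux1997] App. B; [GrothendieckTopology1969] §1.
-/

noncomputable section

set_option linter.dupNamespace false

open CategoryTheory AlgebraicGeometry
open Literature.AlgebraicGeometry.Motives Literature.AlgebraicGeometry.HodgeTheory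
  Literature.AlgebraicGeometry.Resolution
  Literature.AlgebraicTopology.SingularHomology
open Summit.HodgeConjecture.HodgeConjecture.Theses.NodalThetaWeil

namespace Summit.HodgeConjecture.HodgeConjecture.Theorems.NodeDualClassesAlgebraic

/-! ## §1 K-rigidity of algebraicity on the Weil plane -/

section Weil

variable {A : AbelianVariety ℂ}

/-- **Polynomials in a test pull-back `(x·𝟙 + y·φ)^*` preserve `Nᵠ H²ᵠ(A(ℂ); ℂ)`** (`φ ≫ φ = -d`,
`d ≥ 1`): each `(x·𝟙 + y·φ)^*` does — an isogeny for `(x, y) ≠ (0, 0)`, the zero homomorphism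
otherwise (`map_nsmul_id_add_nsmul_mem_algebraicClasses`) — hence so does every polynomial in it
(`HodgeStructure.aeval_apply_mem_of_forall_mem`). In print: `η(K) ⊂ End_ℚ(A)` acts on `H^*(A, ℚ)` by
algebraic correspondences. [cite: Markman2025SecantWeil, Thm. 1.5.1 (proof)] [cite: vanGeemen1994HodgeAV, 4.8] -/
theorem aeval_map_nsmul_id_add_nsmul_mem_algebraicClasses {d : ℕ} (hd : 0 < d) {φ : A ⟶ A}
    (hφ : φ ≫ φ = -(d • 𝟙 A)) (x y : ℕ) (p : Polynomial ℂ) {q : ℕ}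
    {s : complexBetti A.X (2 * q)} (hs : s ∈ algebraicClasses A.X q) :
    Polynomial.aeval (complexBetti.map (x • 𝟙 A + y • φ).hom.hom.hom (2 * q)).hom p s ∈
      algebraicClasses A.X q :=
  HodgeStructure.aeval_apply_mem_of_forall_mem
    (complexBetti.map (x • 𝟙 A + y • φ).hom.hom.hom (2 * q)).hom (algebraicClasses A.X q)
    (fun _ hv ↦ map_nsmul_id_add_nsmul_mem_algebraicClasses hd hφ x y hv) p hs

/-- **K-RIGIDITY OF ALGEBRAICITY ON THE WEIL PLANE.** On a complex abelian `2n`-fold `A` (`n ≥ 1`)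
with `φ ≫ φ = -d·𝟙` (`d ≥ 1`): if an ALGEBRAIC class `s ∈ Nⁿ H²ⁿ(A(ℂ); ℂ)` is Weil-visible — for some
test pull-back `ψ^* = (x·𝟙 + y·φ)^*` and some polynomial `p`, `t = p(ψ^*) s` is a non-zero class of the
Weil plane `E₊ ⊔ E₋ = weilClassesOf A φ n d` — then the WHOLE Weil plane is algebraic. `t` is algebraic
(`aeval_map_nsmul_id_add_nsmul_mem_algebraicClasses`), and one non-zero algebraic Weil class suffices
(`weilClassesOf_le_algebraicClasses_of_exists_ne_zero`, with `H•(A(ℂ)) = ⋀• H¹` and `b₁ = 4n` supplied by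
`hasExteriorCohomologyH1_complexPoints` and `finrank_complexBetti_one`). Thomas: "`π_W` is a polynomial in
the `K`-action" — the certificate is period-free. [cite: vanGeemen1994HodgeAV, 4.9 and proof of Thm. 6.12]
[cite: Thomas2005Nodes, §4] [cite: Markman2025SecantWeil, Thm. 1.5.1 (proof)] -/
theorem weilClassesOf_le_algebraicClasses_of_weilVisible {n d : ℕ} (hn : 0 < n) (hdim : A.dim = 2 * n)
    (hd : 0 < d) {φ : A ⟶ A} (hφ : φ ≫ φ = -(d • 𝟙 A)) {s : complexBetti A.X (2 * n)}
    (hs : s ∈ algebraicClasses A.X n)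
    (hvis : ∃ (x y : ℕ) (p : Polynomial ℂ),
      Polynomial.aeval (complexBetti.map (x • 𝟙 A + y • φ).hom.hom.hom (2 * n)).hom p s ∈
          weilClassesOf A φ n d ∧
        Polynomial.aeval (complexBetti.map (x • 𝟙 A + y • φ).hom.hom.hom (2 * n)).hom p s ≠ 0) :
    weilClassesOf A φ n d ≤ algebraicClasses A.X n := by
  obtain ⟨x, y, p, htW, ht0⟩ := hvis
  have hΛ := AbelianVariety.hasExteriorCohomologyH1_complexPoints A
  have hb₁ : Module.finrank ℂ (complexBetti A.X 1) = 2 * (2 * n) := by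
    rw [AbelianVariety.finrank_complexBetti_one, hdim]
  exact weilClassesOf_le_algebraicClasses_of_exists_ne_zero hn hd hφ hΛ hb₁
    ⟨_, htW, aeval_map_nsmul_id_add_nsmul_mem_algebraicClasses hd hφ x y p hs, ht0⟩

/-- **The route's conclusion for ONE sixfold from ONE Weil-visible algebraic class** (`n = 3`, the
binder block of `WeilSixfolds` / `NodeDualClassesAlgebraic`): on a complex abelian sixfold
`(A, φ ≫ φ = -d·𝟙)`, `d ≥ 1`, carrying a Weil-visible algebraic class `s ∈ N³H⁶`, every class of the
Weil plane — in the route's literal spelling `c = c₁ + c₂`, `(x·𝟙 + y·φ)^* c₁ = (x + iy√d)⁶ c₁`,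
`(x·𝟙 + y·φ)^* c₂ = (x - iy√d)⁶ c₂` — lies in `algebraicClasses A.X 3` (rationality, Hodge type and
support hypotheses are not needed). [cite: vanGeemen1994HodgeAV, 4.9 and proof of Thm. 6.12] [cite: Thomas2005Nodes, §4] -/
theorem weilClass_mem_algebraicClasses_of_weilVisible {d : ℕ} (hd : 0 < d) (hdim : A.dim = 2 * 3)
    {φ : A ⟶ A} (hφ : φ ≫ φ = -(d • 𝟙 A)) {s : complexBetti A.X (2 * 3)}
    (hs : s ∈ algebraicClasses A.X 3)
    (hvis : ∃ (x y : ℕ) (p : Polynomial ℂ),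
      Polynomial.aeval (complexBetti.map (x • 𝟙 A + y • φ).hom.hom.hom (2 * 3)).hom p s ∈
          weilClassesOf A φ 3 d ∧
        Polynomial.aeval (complexBetti.map (x • 𝟙 A + y • φ).hom.hom.hom (2 * 3)).hom p s ≠ 0)
    (c : singularCohomology ℂ ℂ (ComplexPoints A.X) (2 * 3))
    (hw : ∃ c₁ c₂ : singularCohomology ℂ ℂ (ComplexPoints A.X) (2 * 3), c = c₁ + c₂ ∧
      (∀ x y : ℕ, singularCohomology.map ℂ ℂ (AlgPoints.mapContinuous (L := ℂ) (x • 𝟙 A + y • φ).hom.hom.hom) (2 * 3) c₁ =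
        ((x : ℂ) + (y : ℂ) * Complex.I * (Real.sqrt d : ℂ)) ^ (2 * 3) • c₁) ∧
      (∀ x y : ℕ, singularCohomology.map ℂ ℂ (AlgPoints.mapContinuous (L := ℂ) (x • 𝟙 A + y • φ).hom.hom.hom) (2 * 3) c₂ =
        ((x : ℂ) - (y : ℂ) * Complex.I * (Real.sqrt d : ℂ)) ^ (2 * 3) • c₂)) :
    c ∈ algebraicClasses A.X 3 :=
  weilClassesOf_le_algebraicClasses_of_weilVisible (by norm_num) hdim hd hφ hs hvis
    (mem_weilClassesOf_iff.mpr hw)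

end Weil

/-! ## §2 The explicit cycles, in Gysin form -/

section Gysin

variable {A : AbelianVariety ℂ}

/-- **The class of a threefold is algebraic, in Gysin form**: for a smooth projective threefold `V`
with a morphism `h : V ⟶ A` to a smooth projective sixfold and any `b ∈ H⁰(V(ℂ); ℂ) = N⁰H⁰`
(`algebraicClasses_zero`; for `V` connected `b = q · 1` and `h_* b = q · cl_A(h(V))` when `h` is
birational onto its image), `h_* b ∈ N³H⁶(A(ℂ); ℂ) = algebraicClasses A.X 3` — Gysin images of
algebraic classes are algebraic with the codimension shift `0 + 3` (`map_complexGysin_algebraicClasses_le`).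
These are the route's candidate carriers: threefolds through the nodes of a nodal theta member.
[cite: FultonYoungTableaux1997, Appendix B §B.2 Exercise 5] [cite: Thomas2005Nodes, §3 eq. (d)] -/
theorem complexGysin_threefold_mem_algebraicClasses {V : SchemeOver ℂ} (hV : IsSmoothProjective 3 V)
    (hX : IsSmoothProjective (2 * 3) A.X) (h : V ⟶ A.X) (b : complexBetti V 0) :
    complexGysin complexOrientationFamily hV hX h
        (show 0 + 2 * (2 * 3) = 2 * 3 + 2 * 3 by norm_num) b ∈ algebraicClasses A.X 3 := by
  have hb : b ∈ algebraicClasses V 0 := by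
    rw [algebraicClasses_zero]
    trivial
  exact map_complexGysin_algebraicClasses_le (gysinMap_restrictCompl_eq_zero_of_field ℂ)
    complexOrientationFamily hasPoincareDuality_complexOrientationFamily hV hX h
    (d := 0) (e := 3) (show 3 + 3 = 2 * 3 by norm_num) ⟨b, hb, rfl⟩

/-- **Realised node-dual classes push forward to algebraic classes** (the birth skeleton's STUB 2
`stub_liftedTwoTwoClassesAlgebraic`, for the classes the explicit construction realises): for a smooth
projective fivefold `g : Y ⟶ A` (the resolution `D̃ → D ↪ A` of a nodal theta member) and
`b ∈ N²H⁴(Y(ℂ); ℂ) = algebraicClasses Y 2` (a node-dual class realised by threefolds `Ṽ ⊂ D̃`),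
`g_* b ∈ algebraicClasses A.X 3` — the Gysin term of STUB 2 verbatim, codimension shift `2 + 1`. The open
content of STUB 2 is exactly `b ∈ N²H⁴(Y)` for RATIONAL `(2,2)`-classes `b` (HC(2,2) on `Y`); this line
replaces that `∀` by ONE realised class with a certificate (§3).
[cite: Thomas2005Nodes, §3 Lemmas 3–4 and eq. (d)] [cite: Schoen1985, Lemma 1.1] [cite: FultonYoungTableaux1997, Appendix B §B.2 Exercise 5] -/
theorem complexGysin_fivefold_mem_algebraicClasses {Y : SchemeOver ℂ} (hY : IsSmoothProjective 5 Y)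
    (hX : IsSmoothProjective (2 * 3) A.X) (g : Y ⟶ A.X) {b : complexBetti Y (2 * 2)}
    (hb : b ∈ algebraicClasses Y 2) :
    complexGysin complexOrientationFamily hY hX g
        (show 2 * 2 + 2 * (2 * 3) = 2 * 3 + 2 * 5 by norm_num) b ∈ algebraicClasses A.X 3 :=
  map_complexGysin_algebraicClasses_le (gysinMap_restrictCompl_eq_zero_of_field ℂ)
    complexOrientationFamily hasPoincareDuality_complexOrientationFamily hY hX g
    (d := 2) (e := 1) (show 5 + 1 = 2 * 3 by norm_num) ⟨b, hb, rfl⟩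

end Gysin

/-! ## §3 The crux and the target BY NAME from the nodal-boundary carrier statement -/

section NodalBoundary

/-- `IsWeilVisible A φ d s` — the route's Weil-visibility certificate (display only; nothing is
defined; the same text as in `NodalThetaWeilNodalThetaSupportWeilPlaneConiveauRigidity`): some
polynomial in one test pull-back `(x·𝟙 + y·φ)^*`, `x > 0`, moves `s` to a non-zero class of the Weil
plane. -/
local notation3 "IsWeilVisible " A:max φ:max d:max s:max =>
  (∃ (x y : ℕ) (p : Polynomial ℂ), 0 < x ∧
    Polynomial.aeval (complexBetti.map (x • 𝟙 A + y • φ).hom.hom.hom (2 * 3)).hom p s ∈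
        weilClassesOf A φ 3 d ∧
      Polynomial.aeval (complexBetti.map (x • 𝟙 A + y • φ).hom.hom.hom (2 * 3)).hom p s ≠ 0)

/-- `IsNodalThetaMember A Θ k ι` — "`ι` is an `m`-nodal (`m ≥ 1`) member of `|kΘ|`" (display only;
the same text as in `NodalThetaWeilNodalThetaSupportWeilPlaneConiveauRigidity`). -/
local notation3 "IsNodalThetaMember " A:max Θ:max k:max ι:max =>
  (∃ m : ℕ, 1 ≤ m ∧ IsNodalDivisor 5 m ι ∧
    ∃ hI : IsEffectiveCartier (ι).left.ker,
      (CartierDivisor.ofIsEffectiveCartier (ι).left.ker hI).LinEquiv (k • Θ))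

variable {A : AbelianVariety ℂ}

/-- **The minimal form, pointwise: a Weil-visible ALGEBRAIC class gives the conclusion of
`WeilSixfolds` for that sixfold** (§1 with the certificate in the route's `IsWeilVisible` spelling,
`x > 0`). [cite: vanGeemen1994HodgeAV, 4.9 and proof of Thm. 6.12] [cite: Thomas2005Nodes, §4] -/
theorem weilSixfolds_pointwise_of_exists_weilVisible_algebraic {d : ℕ} (hd : 0 < d)
    (hdim : A.dim = 2 * 3) {φ : A ⟶ A} (hφ : φ ≫ φ = -(d • 𝟙 A))
    (hex : ∃ s ∈ algebraicClasses A.X 3, IsWeilVisible A φ d s) :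
    ∀ c : singularCohomology ℂ ℂ (ComplexPoints A.X) (2 * 3), IsRationalClass c →
      IsOfHodgeType (2 * 3) A.X (2 * 3) 3 3 c →
      (∃ c₁ c₂ : singularCohomology ℂ ℂ (ComplexPoints A.X) (2 * 3), c = c₁ + c₂ ∧
        (∀ x y : ℕ, singularCohomology.map ℂ ℂ (AlgPoints.mapContinuous (L := ℂ) (x • 𝟙 A + y • φ).hom.hom.hom) (2 * 3) c₁ =
          ((x : ℂ) + (y : ℂ) * Complex.I * (Real.sqrt d : ℂ)) ^ (2 * 3) • c₁) ∧
        (∀ x y : ℕ, singularCohomology.map ℂ ℂ (AlgPoints.mapContinuous (L := ℂ) (x • 𝟙 A + y • φ).hom.hom.hom) (2 * 3) c₂ =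
          ((x : ℂ) - (y : ℂ) * Complex.I * (Real.sqrt d : ℂ)) ^ (2 * 3) • c₂)) →
      c ∈ algebraicClasses A.X 3 := by
  intro c _ _ hw
  obtain ⟨s, hs, x, y, p, -, htW, ht0⟩ := hex
  exact weilClass_mem_algebraicClasses_of_weilVisible hd hdim hφ hs ⟨x, y, p, htW, ht0⟩ c hw

/-- **THE NODAL-BOUNDARY CARRIER STATEMENT IMPLIES THE ROUTE TARGET `WeilSixfolds` (stmt-2524) BY
NAME.** IF every complex abelian sixfold `(A, φ ≫ φ = -d·𝟙)`, `d ≥ 1`, which is BALANCED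
(`dim (V₊ ∩ H^{1,0}) = 3`, i.e. of Weil type `(3,3)`) carries an ample `Θ`, `k ≥ 2`, a nodal member
`ι : D ↪ A` of `|kΘ|`, a smooth projective threefold `h : V ⟶ D` passing through a NODE of `D` (a
non-regular point), and a class `b ∈ H⁰(V(ℂ); ℂ)` whose Gysin image `(h ≫ ι)_* b ∈ H⁶(A(ℂ); ℂ)` — the
class of the threefold `V ⊂ D ⊂ A` — is Weil-visible, THEN every rational `(3,3)` Weil class on every
Weil sixfold is algebraic. Proof: a non-zero rational `(3,3)` Weil class forces balancedness
(Deligne–Milne 4.4 "only if", `finrank_eq_of_mem_weilClassesOf`); the threefold's class is algebraic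
(§2 `complexGysin_threefold_mem_algebraicClasses`) and visible, so §1 applies. Only "algebraic +
visible" is consumed: `Θ`, `k`, nodality and the node LOCATE the cycle (Thomas's Thm. 1; Kleiman–Altman:
a general high multiple of `Θ` through a threefold of `A⁶` is nodal with `T_pV` maximal isotropic at its
nodes) and ride unused, as in the 7744 composition. [cite: Thomas2005Nodes, Thm. 1 and §3 eq. (d)]
[cite: Schoen1985, Lemma 1.1] [cite: Deligne1982HodgeCycles, Prop. 4.4] [cite: vanGeemen1994HodgeAV, proof of Thm. 6.12] -/
theorem weilSixfolds_of_nodalThetaIsotropicThreefold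
    (hB : ∀ (d : ℕ), 0 < d → ∀ (A : AbelianVariety ℂ) (φ : A ⟶ A), A.dim = 2 * 3 →
      ∀ hsp : IsSmoothProjective (2 * 3) A.X, φ ≫ φ = -(d • 𝟙 A) →
      Module.finrank ℂ ↥(Module.End.eigenspace (complexBetti.map φ.hom.hom.hom 1).hom
            (Complex.I * (Real.sqrt d : ℂ)) ⊓ hodgeOneZero hsp) = 3 →
      ∃ (Θ : CartierDivisor A.X.left) (k : ℕ) (D : SchemeOver ℂ) (ι : D ⟶ A.X),
        Θ.IsAmple ∧ 2 ≤ k ∧ IsNodalThetaMember A Θ k ι ∧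
        ∃ (V : SchemeOver ℂ) (hV : IsSmoothProjective 3 V) (h : V ⟶ D),
          (∃ v : V.left, ¬ IsRegularLocalRing (D.left.presheaf.stalk (h.left.base v))) ∧
          ∃ b : complexBetti V 0,
            IsWeilVisible A φ d (complexGysin complexOrientationFamily hV hsp (h ≫ ι)
              (show 0 + 2 * (2 * 3) = 2 * 3 + 2 * 3 by norm_num) b)) :
    Summit.HodgeConjecture.HodgeConjecture.Theses.NodalThetaWeil.WeilSixfolds := by
  intro d hd A φ hdim hsp hφ c hr hh hw
  have hcW : c ∈ weilClassesOf A φ 3 d := mem_weilClassesOf_iff.mpr hw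
  by_cases hc : c = 0
  · rw [hc]
    exact Submodule.zero_mem _
  have hbal := finrank_eq_of_mem_weilClassesOf (m := 3) (by norm_num) hdim hd hφ hcW hc hh
  obtain ⟨Θ, k, D, ι, -, -, -, V, hV, h, -, b, hvis⟩ := hB d hd A φ hdim hsp hφ hbal
  exact weilSixfolds_pointwise_of_exists_weilVisible_algebraic hd hdim hφ
    ⟨_, complexGysin_threefold_mem_algebraicClasses hV hsp (h ≫ ι) b, hvis⟩ c hr hh hw

/-- **THE CRUX `NodeDualClassesAlgebraic` (stmt-HodgeConjecture-7745) BY NAME FROM THE NODAL-BOUNDARY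
CARRIER STATEMENT** — the same hypothesis as `weilSixfolds_of_nodalThetaIsotropicThreefold`; the crux
is the supported case of the target (drop `c ∈ N¹H⁶`). This is the explicit-construction line for the
crux: per balanced Weil sixfold, ONE threefold at the nodes of a nodal theta member whose class passes
the `K`-certificate closes the crux (and the target) for that sixfold; no transport, no monodromy, no
Hodge conjecture one dimension down for ALL `(2,2)`-classes. [cite: Thomas2005Nodes, Thm. 1 and §3 eq. (d)]
[cite: Schoen1985, Lemma 1.1] [cite: Deligne1982HodgeCycles, Prop. 4.4] -/
theorem nodeDualClassesAlgebraic_of_nodalThetaIsotropicThreefold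
    (hB : ∀ (d : ℕ), 0 < d → ∀ (A : AbelianVariety ℂ) (φ : A ⟶ A), A.dim = 2 * 3 →
      ∀ hsp : IsSmoothProjective (2 * 3) A.X, φ ≫ φ = -(d • 𝟙 A) →
      Module.finrank ℂ ↥(Module.End.eigenspace (complexBetti.map φ.hom.hom.hom 1).hom
            (Complex.I * (Real.sqrt d : ℂ)) ⊓ hodgeOneZero hsp) = 3 →
      ∃ (Θ : CartierDivisor A.X.left) (k : ℕ) (D : SchemeOver ℂ) (ι : D ⟶ A.X),
        Θ.IsAmple ∧ 2 ≤ k ∧ IsNodalThetaMember A Θ k ι ∧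
        ∃ (V : SchemeOver ℂ) (hV : IsSmoothProjective 3 V) (h : V ⟶ D),
          (∃ v : V.left, ¬ IsRegularLocalRing (D.left.presheaf.stalk (h.left.base v))) ∧
          ∃ b : complexBetti V 0,
            IsWeilVisible A φ d (complexGysin complexOrientationFamily hV hsp (h ≫ ι)
              (show 0 + 2 * (2 * 3) = 2 * 3 + 2 * 3 by norm_num) b)) :
    Summit.HodgeConjecture.HodgeConjecture.Theses.NodalThetaWeil.NodeDualClassesAlgebraic :=
  fun d hd A φ hdim hsp hφ c hr hh hw _ ↦
    weilSixfolds_of_nodalThetaIsotropicThreefold hB d hd A φ hdim hsp hφ c hr hh hw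

end NodalBoundary

/-! ## §4 The minimal form is an honest equivalence split -/

section Minimal

/-- `IsWeilVisible A φ d s` (display only; as in §3). -/
local notation3 "IsWeilVisible " A:max φ:max d:max s:max =>
  (∃ (x y : ℕ) (p : Polynomial ℂ), 0 < x ∧
    Polynomial.aeval (complexBetti.map (x • 𝟙 A + y • φ).hom.hom.hom (2 * 3)).hom p s ∈
        weilClassesOf A φ 3 d ∧
      Polynomial.aeval (complexBetti.map (x • 𝟙 A + y • φ).hom.hom.hom (2 * 3)).hom p s ≠ 0)

variable {A : AbelianVariety ℂ}

/-- **Every non-zero class of the Weil plane is Weil-visible** with the trivial certificate `ψ = 𝟙`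
(`x = 1`, `y = 0`), `p = X`: `X(𝟙^*) s = s`. [cite: vanGeemen1994HodgeAV, 4.9] -/
theorem weilVisible_of_mem_weilClassesOf_of_ne_zero {d : ℕ} {φ : A ⟶ A}
    {s : complexBetti A.X (2 * 3)} (hsW : s ∈ weilClassesOf A φ 3 d) (hs0 : s ≠ 0) :
    IsWeilVisible A φ d s := by
  have hid : Polynomial.aeval (complexBetti.map ((1 : ℕ) • 𝟙 A + (0 : ℕ) • φ).hom.hom.hom (2 * 3)).hom
      (Polynomial.X : Polynomial ℂ) s = s := by
    rw [Polynomial.aeval_X]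
    have h1 : ((1 : ℕ) • 𝟙 A + (0 : ℕ) • φ : A ⟶ A) = 𝟙 A := by simp
    rw [h1]
    exact abelianVariety_map_id_apply s
  exact ⟨1, 0, Polynomial.X, Nat.one_pos, hid.symm ▸ hsW, hid.symm ▸ hs0⟩

/-- **On a BALANCED Weil sixfold, the Hodge conjecture for the Weil plane (the conclusion of
`WeilSixfolds` for that sixfold) is EQUIVALENT to the existence of one Weil-visible algebraic class.**
`←` is §1; `→`: the Weil plane contains a non-zero RATIONAL class
(`exists_isRationalClass_ne_zero_mem_weilClassesOf`), of Hodge type `(3,3)` on a balanced sixfold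
(`isOfHodgeType_of_mem_weilClassesOf`, Deligne–Milne 4.4 "if"), algebraic by hypothesis and visible
with the trivial certificate. So the nodal-boundary residual of §3 is, sixfold by sixfold, the Hodge
conjecture for the Weil plane IN CERTIFICATE FORM — an honest equivalence split, the difficulty
located in exhibiting the cycle. [cite: Deligne1982HodgeCycles, Prop. 4.4] [cite: vanGeemen1994HodgeAV, 4.9–4.10 and Lemma 5.2] -/
theorem weilSixfolds_pointwise_iff_exists_weilVisible_algebraic {d : ℕ} (hd : 0 < d)
    (hdim : A.dim = 2 * 3) {φ : A ⟶ A} (hφ : φ ≫ φ = -(d • 𝟙 A))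
    (hbal : Module.finrank ℂ ↥(Module.End.eigenspace (complexBetti.map φ.hom.hom.hom 1).hom
          (Complex.I * (Real.sqrt d : ℂ)) ⊓ hodgeOneZero (isSmoothProjective_of_dim_eq' hdim)) = 3) :
    (∀ c : singularCohomology ℂ ℂ (ComplexPoints A.X) (2 * 3), IsRationalClass c →
      IsOfHodgeType (2 * 3) A.X (2 * 3) 3 3 c →
      (∃ c₁ c₂ : singularCohomology ℂ ℂ (ComplexPoints A.X) (2 * 3), c = c₁ + c₂ ∧
        (∀ x y : ℕ, singularCohomology.map ℂ ℂ (AlgPoints.mapContinuous (L := ℂ) (x • 𝟙 A + y • φ).hom.hom.hom) (2 * 3) c₁ =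
          ((x : ℂ) + (y : ℂ) * Complex.I * (Real.sqrt d : ℂ)) ^ (2 * 3) • c₁) ∧
        (∀ x y : ℕ, singularCohomology.map ℂ ℂ (AlgPoints.mapContinuous (L := ℂ) (x • 𝟙 A + y • φ).hom.hom.hom) (2 * 3) c₂ =
          ((x : ℂ) - (y : ℂ) * Complex.I * (Real.sqrt d : ℂ)) ^ (2 * 3) • c₂)) →
      c ∈ algebraicClasses A.X 3) ↔
    ∃ s ∈ algebraicClasses A.X 3, IsWeilVisible A φ d s := by
  constructor
  · intro hW
    obtain ⟨c, hcW, hc0, hcr⟩ := exists_isRationalClass_ne_zero_mem_weilClassesOf (n := 3)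
      (by norm_num) hdim hd hφ
    have hh : IsOfHodgeType (2 * 3) A.X (2 * 3) 3 3 c :=
      isOfHodgeType_of_mem_weilClassesOf (m := 3) (by norm_num) hdim hd hφ hbal hcW
    exact ⟨c, hW c hcr hh (mem_weilClassesOf_iff.mp hcW),
      weilVisible_of_mem_weilClassesOf_of_ne_zero hcW hc0⟩
  · intro hex
    exact weilSixfolds_pointwise_of_exists_weilVisible_algebraic hd hdim hφ hex

/-- **The conclusion of the crux `NodeDualClassesAlgebraic` for ONE sixfold from ONE Weil-visible
algebraic class** (no balancedness needed in this direction; the support hypothesis `c ∈ N¹H⁶` is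
dropped, so this is in fact the conclusion of `WeilSixfolds` for that sixfold).
[cite: vanGeemen1994HodgeAV, 4.9 and proof of Thm. 6.12] [cite: Thomas2005Nodes, §4] -/
theorem nodeDualClassesAlgebraic_pointwise_of_exists_weilVisible_algebraic {d : ℕ} (hd : 0 < d)
    (hdim : A.dim = 2 * 3) {φ : A ⟶ A} (hφ : φ ≫ φ = -(d • 𝟙 A))
    (hex : ∃ s ∈ algebraicClasses A.X 3, IsWeilVisible A φ d s) :
    ∀ c : singularCohomology ℂ ℂ (ComplexPoints A.X) (2 * 3), IsRationalClass c →
      IsOfHodgeType (2 * 3) A.X (2 * 3) 3 3 c →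
      (∃ c₁ c₂ : singularCohomology ℂ ℂ (ComplexPoints A.X) (2 * 3), c = c₁ + c₂ ∧
        (∀ x y : ℕ, singularCohomology.map ℂ ℂ (AlgPoints.mapContinuous (L := ℂ) (x • 𝟙 A + y • φ).hom.hom.hom) (2 * 3) c₁ =
          ((x : ℂ) + (y : ℂ) * Complex.I * (Real.sqrt d : ℂ)) ^ (2 * 3) • c₁) ∧
        (∀ x y : ℕ, singularCohomology.map ℂ ℂ (AlgPoints.mapContinuous (L := ℂ) (x • 𝟙 A + y • φ).hom.hom.hom) (2 * 3) c₂ =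
          ((x : ℂ) - (y : ℂ) * Complex.I * (Real.sqrt d : ℂ)) ^ (2 * 3) • c₂)) →
      c ∈ supportedClasses A.X (2 * 3) 1 → c ∈ algebraicClasses A.X 3 :=
  fun c hr hh hw _ ↦ weilSixfolds_pointwise_of_exists_weilVisible_algebraic hd hdim hφ hex c hr hh hw

end Minimal

end Summit.HodgeConjecture.HodgeConjecture.Theorems.NodeDualClassesAlgebraic

end
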